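import Mathlib
import HarnessLib
import Summits.ValiantsHypothesis.ValiantsHypothesis.Theses.MonotoneRestoration
import Literature.Computability.AlgebraicComplexity.ArithCircuit
import Literature.Computability.AlgebraicComplexity.ArithCircuitProofs
import Literature.Computability.AlgebraicComplexity.MonotoneStructure
import Literature.Computability.AlgebraicComplexity.PermanentIrreducible
import Literature.ModelTheory.FiniteModelTheory.CkEquiv
import Summits.ValiantsHypothesis.ValiantsHypothesis.Theorems.MonotoneRestorationMonotoneRestorationQPCosetCount
import Summits.ValiantsHypothesis.ValiantsHypothesis.Theorems.MonotoneRestorationMonotoneRestorationQPSymmetricLB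
import Summits.ValiantsHypothesis.ValiantsHypothesis.Theorems.MonotoneRestorationMonotoneRestorationQPSupportSymmetrisation
import Summits.ValiantsHypothesis.ValiantsHypothesis.Theorems.MonotoneRestorationMonotoneRestorationQPSparseRegime
import Summits.ValiantsHypothesis.ValiantsHypothesis.Theorems.MonotoneRestorationMonotoneRestorationQPBeta
import Literature.Computability.AlgebraicComplexity.SymmetricArithCircuit
import Literature.Computability.AlgebraicComplexity.DawarWilsenach2025Proofs
import Literature.GroupTheory.PermutationGroups.SmallIndexSubgroups
import Summits.ValiantsHypothesis.ValiantsHypothesis.Theorems.MonotoneRestorationQP.Negative.LoadBearing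
import Summits.ValiantsHypothesis.ValiantsHypothesis.Theorems.MonotoneRestorationMonotoneRestorationQPPermSupportCount

/-! TTRL-lite variant V19042 of stmt-ValiantsHypothesis-15886 -/

-- `Summit.ValiantsHypothesis.ValiantsHypothesis.…` is the tree's mandated single-conjunct layout
-- (Sub = Summit), so the duplicated namespace component is intended.
set_option linter.dupNamespace false

namespace Summit.ValiantsHypothesis.ValiantsHypothesis.Theorems

open Summit.ValiantsHypothesis.ValiantsHypothesis.Theses.MonotoneRestoration
open Literature.Computability.AlgebraicComplexity

/-- TTRL-lite variant V19042 (move `small_case`, `[T_le_1]`) of stub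
`stub_altFixing_orbit_dichotomy` of crux `MonotoneRestorationQP` (item stmt-ValiantsHypothesis-15886):
if every even permutation `ρ` fixing `X` pointwise sends `q` (via the diagonal relabelling
`x_{ab} ↦ x_{ρ a, ρ b}`) into a finite container `T` with `T.card ≤ 1`, then every such `ρ`
fixes `q`. Proof: `ρ = 1` shows `q ∈ T` (relabelling by `1` is `rename id = id`), and a set of
card `≤ 1` containing both `q` and its image forces them equal (`Finset.card_le_one`).
Pure bookkeeping — no size hypotheses on `X` and no group theory. -/
theorem stub_altFixing_orbit_dichotomy_var19042 :
    ∀ (n : ℕ) (K : Type) [CommSemiring K] (q : MvPolynomial (Fin n × Fin n) K)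
      (X : Finset (Fin n)) (T : Finset (MvPolynomial (Fin n × Fin n) K)), T.card ≤ 1 →
      (∀ ρ : Equiv.Perm (Fin n), (∀ x ∈ X, ρ x = x) → Equiv.Perm.sign ρ = 1 →
        MvPolynomial.rename (fun p : Fin n × Fin n => (ρ p.1, ρ p.2)) q ∈ T) →
      ∀ ρ : Equiv.Perm (Fin n), (∀ x ∈ X, ρ x = x) → Equiv.Perm.sign ρ = 1 →
        MvPolynomial.rename (fun p : Fin n × Fin n => (ρ p.1, ρ p.2)) q = q := by
  intro n K _ q X T hT horb ρ hfix hsign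
  have h1 := horb 1 (fun x _ => rfl) (map_one _)
  have hid : (fun p : Fin n × Fin n => ((1 : Equiv.Perm (Fin n)) p.1, (1 : Equiv.Perm (Fin n)) p.2))
      = id := by
    funext p
    simp
  rw [hid, MvPolynomial.rename_id] at h1
  have hq : q ∈ T := by simpa using h1
  exact Finset.card_le_one.mp hT _ (horb ρ hfix hsign) _ hq

end Summit.ValiantsHypothesis.ValiantsHypothesis.Theorems
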